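import Summits.QuantumFields.YangMills.Theorems.BalabanUVNodesN16Thm2TorusOfCover

/-!
# Route «BalabanUVNodes», next to DAG node N16 — [B8] THEOREM 2 AT THE SETUP-TORUS OBJECTS IS THEOREM 2 ON PERIODIC `ℤᵈ` DATA
# (the CONVERSE of `B8Thm2SetupTorus.thm2SetupSUAt_of_thm2TorusAt`), HENCE THEOREM 2 IN `Thm2SetupSUAt` CURRENCY DESCENDS ALONG
# COVERS, AND A VOLUME FLOOR ON A SETUP-CURRENCY SUPPLIER OF THE EX KNIT'S SOCKET `hThm2S` IS NO FLOOR

Cell `pub/ym-inputs`, seat `ym-inputs-p06` gen 6 (I-08 row = the Theorem-2 socket of the EX knit; located rider LF-2VOL), ONE def-free helper file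
INSIDE the seat's own chain (`BalabanUVNodesN16Thm2TorusOfCover`, gen 5, ✓p636579); `--supports` the EX ∕ T2 socket; count-neutral.

WHY.  Gen 5's `Thm2TorusOfCover.thm2TorusAt_of_dvd'` descends [Balaban1985RegularSpaces] Theorem 2 along covers in the currency
`B8Thm2TorusAt.Thm2TorusAt` (Theorem 2 read on `P`-periodic `ℤᵈ` data), and its `hThm2S_of_floor` removes a volume floor `k₀ ≤ F.m` from a
supplier of the socket that speaks THAT currency.  The supplier of record (cell `lit-balaban`, files A13 `B8Thm2T3FamilyBinder.hThm2_of_constants`,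
A14 `B8Thm2TorusKnitCubeCore.hThm2_of_core`, A15 `B8Thm2T3FamilyBinderSharp.hThm2_of_core_sharp`) speaks the SETUP currency
`B8Thm2SetupTorus.Thm2SetupSUAt (F.P K) 2 (K − n) (eta F n K) …` of the socket itself, with the floor `k₀ ≤ F.m` (A14) ∕ `k₀ ≤ F.m + n` (A15).
Gen 5 recorded «Setup currency does not descend without Setup-level cover maps — located, not typed».  It does descend, and no cover map is
needed: `B8Thm2SetupTorus` derives `Thm2SetupSUAt` from `Thm2TorusAt` at the period `sitesPerDir 0` (`thm2SetupSUAt_of_thm2TorusAt`, one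
direction — its docstring: «the converse — every periodic `ℤᵈ` datum descends, `descendCfg` — is not needed and not stated»), and THE CONVERSE HOLDS
over that file's own descent letters: a `sitesPerDir 0`-periodic unitary-valued `ℤᵈ` configuration IS the pullback `cfgPull` of a torus field
(`pull_descendCfg`), an `SU(N)`-valued one is `toUField` of an `SU(N)` field, the torus solution pulls back to a periodic `ℤᵈ` gauge transformation
with (1.29) and (1.36)–(1.39) (`gaugePull_periodic`, `concl2Setup_iff`), and a periodic `ℤᵈ` competitor descends (`exists_gaugePull_eq`,
`exists_toUGauge_eq`), so uniqueness on the torus is uniqueness among periodic `ℤᵈ` gauges.  Hence `Thm2SetupSUAt P N k η … Reg ↔ Thm2TorusAt P.L k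
(sitesPerDir 0) η … SU(N) Reg`, and gen 5's descent composes on both sides: Theorem 2 in Setup currency at the `Lʲ`-fold cover member
`(⟨L, hL, F.m + j, _⟩, K)` gives Theorem 2 in Setup currency at the member `(F, K)` (same `η, β₀, B₁, B₂, len`, window constant `min c₁ (16B₁)⁻¹`,
or the same `c₁` in the regime `16·B₁·c₁ ≤ 1`).

USE (located, not asserted).  With A14's binder: for a member `(F, n, K)` below the floor, read A14 at the cover member `(⟨L, hL, F.m + k₀, _⟩, n, K)`
(floor met, same `η = eta F n K`, same `(B₁, c₁)`), its two per-member arrows (analytic cube data `han`, (B)-lines `hb9`) being read THERE, and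
descend with `thm2SetupSUAt_of_cover F k₀ K` (§2) — §3 packages this for the whole family (`…_hyp`, A14's floor shape; `…_hyp_sharp`, A15's).
What this does NOT do: discharge `han` ∕ `hb9` (they stay the supplier's displayed antecedents, now at the cover member), touch LF-1EX (`L ≥ 5`),
or assert Theorem 2 anywhere.

WHAT THIS FILE PROVES (kernel, theorems only, 0 `def`, 0 sorry):
§1 `exists_cfgPull_eq`, `exists_toUField_eq` (descent of periodic unitary ∕ special-unitary `ℤᵈ` data to torus fields);
   **`thm2TorusAt_of_thm2SetupAt`** (`G ≤ unitaryUnits`), **`thm2SetupAt_specialUnitary_of_thm2SetupSUAt`**, **`thm2TorusAt_of_thm2SetupSUAt`**,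
   `thm2SetupAt_iff_thm2TorusAt`, **`thm2SetupSUAt_iff_thm2TorusAt`** — the converse junction and the equivalences.
§2 **`thm2SetupSUAt_of_cover`** (`F : T3Family`, cover exponent `j`, run `K`, level `k ≤ F.m + K`, `η > 0`, `0 < B₁`; window `min c₁ (16B₁)⁻¹`),
   **`thm2SetupSUAt_of_cover_of_regime`** (same `c₁` under `16·B₁·c₁ ≤ 1`, `0 ≤ B₁`).
§3 **`thm2SetupSUAt_allMembers_of_floorS`** (gen 5's §4 with the supplier in `Thm2SetupSUAt` currency), **`hThm2S_of_floorS`** (conclusion = the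
   EX knit's displayed socket `hThm2S` token for token, from a Setup-currency supplier allowed a floor `k₀ ≤ F.m`),
   **`thm2SetupSUAt_allMembers_of_floorS_hyp`** (the supplier's per-member antecedent `H F n K` carried and read at the cover member — A14's shape),
   **`thm2SetupSUAt_allMembers_of_floorS_hyp_sharp`** (A15's shape: floor `k₀ ≤ F.m + n` after `n K`, cover exponent `k₀ − n`).
HONEST FRAMING: plumbing over landed letters by name; Theorem 2 is asserted for nothing (it is a hypothesis in every statement); no per-member
antecedent of any supplier is discharged; L-FLOOR none (`1 < L` from `T3Family` only where gen 5's descent needs `1 ≤ L`); no summit ∕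
sub-problem ∕ stub statement is proved; rung R3 bookkeeping, not T⁴, not Clay; YM gap NOT proved; count-neutral.
-/

set_option autoImplicit false

open scoped BigOperators Matrix Matrix.Norms.L2Operator

namespace Summit.QuantumFields.YangMills.BalabanUVNodes.N16.Thm2SetupTorusOfCover

open Literature.MathematicalPhysics.QuantumFieldTheory.Balaban1983to89
open B7Prop1Explicit renaming Site → LSite
open B7Prop1Explicit (e)
open B7Prop2Explicit (unitaryUnits mem_unitaryUnits)
open B7Prop2SpecialUnitary (specialUnitaryUnits mem_specialUnitaryUnits specialUnitaryUnits_le_unitaryUnits)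
open B12Ineq417Flat (shiftCfg)
open B10Eq27TorusAxialLog (transl rel transl_rel pull pull_apply unitsField val_unitsField toUField)
open B10Eq68TorusRegularity (InSpace)
open B8Thm2TorusAt (Thm2TorusAt)
open B8Thm2SetupTorus (descendCfg pull_descendCfg cfgPull gaugePull cfgPull_apply cfgPull_mul gaugePull_apply gaugePull_periodic
  exists_gaugePull_eq InAxT Restr129T Hyp135T Concl2Setup concl2Setup_iff Thm2SetupAt Thm2SetupSUAt toUGauge toUnits_toUGauge_mem
  exists_toUGauge_eq unitsField_toUField_mem toUField_mul thm2SetupAt_of_thm2TorusAt thm2SetupSUAt_of_thm2TorusAt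
  inSpace_univ_iff_inAk_pull pow_dvd_period)
open T3ContinuumYM3Torus (T3Family)
open T3SectALandauChart (eta eta_pos)
open Thm2TorusOfCover (thm2TorusAt_of_dvd thm2TorusAt_of_dvd' sitesPerDir_zero_cover)

/-! ## §1 The converse junction: Theorem 2 at the Setup-torus objects ⟹ Theorem 2 on periodic `ℤᵈ` data -/

section Converse

variable {P : Params} {N : ℕ}

/-- **DESCENT OF A PERIODIC UNITARY-VALUED `ℤᵈ` CONFIGURATION TO A `U(N)` TORUS FIELD** whose `ℤᵈ` reading `cfgPull` it is
(`B8Thm2SetupTorus.pull_descendCfg` with the values repackaged in `Matrix.unitaryGroup`). [cite: Balaban1985RegularSpaces, (1.3) p.77; Balaban1985Averaging, (19) p.21] -/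
theorem exists_cfgPull_eq {W : LSite P.d → Fin P.d → (Matrix (Fin N) (Fin N) ℂ)ˣ}
    (hW : ∀ (z : LSite P.d) (μ : Fin P.d), W z μ ∈ unitaryUnits (Matrix (Fin N) (Fin N) ℂ))
    (hper : ∀ i : Fin P.d, shiftCfg (((P.sitesPerDir 0 : ℕ) : ℤ) • e i) W = W) :
    ∃ U : GaugeField P 0 (Matrix.unitaryGroup (Fin N) ℂ), cfgPull P U = W := by
  refine ⟨fun b => ⟨((descendCfg W (0 : Site P 0) b : (Matrix (Fin N) (Fin N) ℂ)ˣ) : Matrix (Fin N) (Fin N) ℂ),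
    (mem_unitaryUnits).1 (hW _ _)⟩, ?_⟩
  have hU : unitsField (fun b : PBond P 0 => (⟨((descendCfg W (0 : Site P 0) b : (Matrix (Fin N) (Fin N) ℂ)ˣ) : Matrix (Fin N) (Fin N) ℂ),
      (mem_unitaryUnits).1 (hW _ _)⟩ : Matrix.unitaryGroup (Fin N) ℂ)) = descendCfg W (0 : Site P 0) :=
    funext fun _ => Units.ext rfl
  show pull (unitsField _) 0 = W
  rw [hU]
  exact pull_descendCfg 0 hper

/-- A `U(N)` torus field whose bond variables lie in `SU(N)` IS `toUField` of an `SU(N)` torus field. [cite: Balaban1985Averaging, (19) p.21] -/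
theorem exists_toUField_eq {U : GaugeField P 0 (Matrix.unitaryGroup (Fin N) ℂ)} (hU : ∀ b, unitsField U b ∈ specialUnitaryUnits (Fin N)) :
    ∃ V : GaugeField P 0 (Matrix.specialUnitaryGroup (Fin N) ℂ), toUField V = U :=
  ⟨fun b => ⟨((U b : Matrix.unitaryGroup (Fin N) ℂ) : Matrix (Fin N) (Fin N) ℂ), (mem_specialUnitaryUnits).1 (hU b)⟩,
    funext fun _ => Subtype.ext rfl⟩

variable [NeZero N]

/-- **THE CONVERSE JUNCTION: `Thm2SetupAt` (Setup-torus objects, gauge group `G ≤ unitaryUnits M_N(ℂ)`) ⟹ `Thm2TorusAt` (periodic-`ℤᵈ`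
reading, period `sitesPerDir 0`).**  Periodic `G`-valued `ℤᵈ` data descend to torus fields (`exists_cfgPull_eq`) in `𝔄_k`
(`inSpace_univ_iff_inAk_pull`, `cfgPull_mul`); the torus gauge transformation pulls back to a periodic `ℤᵈ` one with (1.29) and `Concl2T`
(`gaugePull_periodic`, `concl2Setup_iff`.1).  UNIQUENESS, quantifiers explicit: the `ℤᵈ` clause quantifies over EVERY `G`-valued `sitesPerDir 0`-periodic
`v : ℤᵈ → (M_N(ℂ))ˣ` with (1.29) and `Concl2T`; such a `v` IS `gaugePull P u′` for a torus gauge transformation `u′` (`exists_gaugePull_eq` — SURJECTIVITY of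
`gaugePull` onto the periodic unitary-valued gauges is what this direction uses; the forward junction `thm2SetupAt_of_thm2TorusAt` uses its INJECTIVITY),
`u′` is `G`-valued on the torus (`transl_rel`) and satisfies the torus clauses (`Restr129T` is (1.29) of the pullback by definition, `concl2Setup_iff`.2),
so the torus uniqueness clause gives `u′ = u`, whence `v = gaugePull P u`.  Needed NOW (and not in `B8Thm2SetupTorus`, whose docstring calls this direction
«not needed and not stated») because the supplier of record of the EX knit's socket speaks `Thm2SetupSUAt` while gen 5's cover descent speaks `Thm2TorusAt`.
[cite: Balaban1985RegularSpaces, Thm 2 p.83, p.77 («Ω_j = T_η»)] -/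
theorem thm2TorusAt_of_thm2SetupAt {k : ℕ} {η β₀ B₁ B₂ c₁ : ℝ} {len : LSite P.d → ℝ} {G : Subgroup (Matrix (Fin N) (Fin N) ℂ)ˣ}
    (hG : G ≤ unitaryUnits (Matrix (Fin N) (Fin N) ℂ)) {Reg : (LSite P.d → Fin P.d → (Matrix (Fin N) (Fin N) ℂ)ˣ) → Prop}
    (h : Thm2SetupAt P N k η β₀ B₁ B₂ c₁ len G Reg) :
    Thm2TorusAt P.L k (((P.sitesPerDir 0 : ℕ) : ℤ)) η β₀ B₁ B₂ c₁ len G Reg := by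
  intro α₀ α₁ hα₀ hα₁ hc W₀ W' hW₀G hW'G hW₀P hW'P h33 hReg h34 hax h35
  obtain ⟨U₀, rfl⟩ := exists_cfgPull_eq (fun z μ => hG (hW₀G z μ)) hW₀P
  obtain ⟨U', rfl⟩ := exists_cfgPull_eq (fun z μ => hG (hW'G z μ)) hW'P
  have hU₀G : ∀ b, unitsField U₀ b ∈ G := fun b => by
    have := hW₀G (rel 0 b.src) b.dir
    rwa [cfgPull_apply, transl_rel] at this
  have hU'G : ∀ b, unitsField U' b ∈ G := fun b => by
    have := hW'G (rel 0 b.src) b.dir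
    rwa [cfgPull_apply, transl_rel] at this
  have h33' : InSpace k (fun _ => (Set.univ : Set (Site P 0))) α₀ η U₀ := (inSpace_univ_iff_inAk_pull k α₀ η U₀).2 h33
  have h34' : InSpace k (fun _ => (Set.univ : Set (Site P 0))) α₀ η (fun b => U' b * U₀ b) := by
    rw [← cfgPull_mul] at h34
    exact (inSpace_univ_iff_inAk_pull k α₀ η _).2 h34
  have hax' : InAxT P k U₀ (fun b => U' b * U₀ b) := by
    unfold InAxT; rw [cfgPull_mul]; exact hax
  obtain ⟨u, ⟨huG, h129, hC⟩, huniq⟩ := h hα₀ hα₁ hc U₀ U' hU₀G hU'G h33' hReg h34' hax' h35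
  refine ⟨gaugePull P u, ⟨fun z => ?_, fun z i => gaugePull_periodic u z i, h129,
    (concl2Setup_iff k η β₀ B₁ B₂ len α₀ α₁ U₀ U' u).1 hC⟩, fun v hvG hvP h129' hC' => ?_⟩
  · rw [gaugePull_apply]; exact huG _
  · obtain ⟨u', rfl⟩ := exists_gaugePull_eq (P := P) (fun z => hG (hvG z)) hvP
    have hu'G : ∀ x, Unitary.toUnits (u' x) ∈ G := fun x => by
      have := hvG (rel 0 x)
      rwa [gaugePull_apply, transl_rel] at this
    rw [huniq u' hu'G h129' ((concl2Setup_iff k η β₀ B₁ B₂ len α₀ α₁ U₀ U' u').2 hC')]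

/-- **`Thm2SetupAt` at the period `sitesPerDir 0` IS `Thm2TorusAt`** (`G ≤ unitaryUnits`): `B8Thm2SetupTorus.thm2SetupAt_of_thm2TorusAt` and its
converse. [cite: Balaban1985RegularSpaces, Thm 2 p.83, p.77] -/
theorem thm2SetupAt_iff_thm2TorusAt {k : ℕ} {η β₀ B₁ B₂ c₁ : ℝ} {len : LSite P.d → ℝ} {G : Subgroup (Matrix (Fin N) (Fin N) ℂ)ˣ}
    (hG : G ≤ unitaryUnits (Matrix (Fin N) (Fin N) ℂ)) {Reg : (LSite P.d → Fin P.d → (Matrix (Fin N) (Fin N) ℂ)ˣ) → Prop} :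
    Thm2SetupAt P N k η β₀ B₁ B₂ c₁ len G Reg ↔ Thm2TorusAt P.L k (((P.sitesPerDir 0 : ℕ) : ℤ)) η β₀ B₁ B₂ c₁ len G Reg :=
  ⟨thm2TorusAt_of_thm2SetupAt hG, thm2SetupAt_of_thm2TorusAt hG⟩

omit [NeZero N] in
/-- **The `SU(N)`-native form gives back the `G = SU(N)` instance of `Thm2SetupAt`**: `U(N)` fields with `SU(N)` values ARE `toUField` of `SU(N)`
fields (`exists_toUField_eq`, `toUField_mul`), the `SU(N)` solution is read in `U(N)` through `toUGauge` (values in `specialUnitaryUnits`,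
`toUnits_toUGauge_mem`).  UNIQUENESS, quantifiers explicit: the `Thm2SetupAt` clause quantifies over EVERY `U(N)`-valued torus gauge transformation `v` with
`SU(N)` values, (1.29) and `Concl2Setup`; such a `v` IS `toUGauge P N u′` (`exists_toUGauge_eq` — surjectivity onto the `SU(N)`-valued ones; the forward
direction `B8Thm2SetupTorus.thm2SetupSUAt_of_thm2SetupAt` uses `toUGauge_injective`), the `SU(N)`-native uniqueness clause gives `u′ = u`, whence
`v = toUGauge P N u`.  The converse of `B8Thm2SetupTorus.thm2SetupSUAt_of_thm2SetupAt`. [cite: Balaban1985RegularSpaces, Thm 2 p.83; Balaban1985Averaging, (19) p.21] -/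
theorem thm2SetupAt_specialUnitary_of_thm2SetupSUAt {k : ℕ} {η β₀ B₁ B₂ c₁ : ℝ} {len : LSite P.d → ℝ}
    {Reg : (LSite P.d → Fin P.d → (Matrix (Fin N) (Fin N) ℂ)ˣ) → Prop} (h : Thm2SetupSUAt P N k η β₀ B₁ B₂ c₁ len Reg) :
    Thm2SetupAt P N k η β₀ B₁ B₂ c₁ len (specialUnitaryUnits (Fin N)) Reg := by
  intro α₀ α₁ hα₀ hα₁ hc U₀ U' hU₀G hU'G h33 hReg h34 hax h35
  obtain ⟨V₀, rfl⟩ := exists_toUField_eq hU₀G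
  obtain ⟨V', rfl⟩ := exists_toUField_eq hU'G
  rw [← toUField_mul] at h34 hax
  obtain ⟨u, ⟨h129, hC⟩, huniq⟩ := h hα₀ hα₁ hc V₀ V' h33 hReg h34 hax h35
  refine ⟨toUGauge P N u, ⟨toUnits_toUGauge_mem u, h129, hC⟩, fun v hvG h129' hC' => ?_⟩
  obtain ⟨u', rfl⟩ := exists_toUGauge_eq hvG
  rw [huniq u' h129' hC']

/-- **THE CONVERSE JUNCTION IN THE SOCKET'S CURRENCY: `Thm2SetupSUAt P N k η …` ⟹ `Thm2TorusAt P.L k (sitesPerDir 0) η … SU(N) …`.**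
[cite: Balaban1985RegularSpaces, Thm 2 p.83, p.77 («Ω_j = T_η»)] -/
theorem thm2TorusAt_of_thm2SetupSUAt {k : ℕ} {η β₀ B₁ B₂ c₁ : ℝ} {len : LSite P.d → ℝ}
    {Reg : (LSite P.d → Fin P.d → (Matrix (Fin N) (Fin N) ℂ)ˣ) → Prop} (h : Thm2SetupSUAt P N k η β₀ B₁ B₂ c₁ len Reg) :
    Thm2TorusAt P.L k (((P.sitesPerDir 0 : ℕ) : ℤ)) η β₀ B₁ B₂ c₁ len (specialUnitaryUnits (Fin N)) Reg :=
  thm2TorusAt_of_thm2SetupAt specialUnitaryUnits_le_unitaryUnits (thm2SetupAt_specialUnitary_of_thm2SetupSUAt h)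

/-- **`Thm2SetupSUAt` IS `Thm2TorusAt` at `SU(N)` and the period `sitesPerDir 0`** (`B8Thm2SetupTorus.thm2SetupSUAt_of_thm2TorusAt` and its converse).
[cite: Balaban1985RegularSpaces, Thm 2 p.83, p.77] -/
theorem thm2SetupSUAt_iff_thm2TorusAt {k : ℕ} {η β₀ B₁ B₂ c₁ : ℝ} {len : LSite P.d → ℝ}
    {Reg : (LSite P.d → Fin P.d → (Matrix (Fin N) (Fin N) ℂ)ˣ) → Prop} :
    Thm2SetupSUAt P N k η β₀ B₁ B₂ c₁ len Reg ↔ Thm2TorusAt P.L k (((P.sitesPerDir 0 : ℕ) : ℤ)) η β₀ B₁ B₂ c₁ len (specialUnitaryUnits (Fin N)) Reg :=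
  ⟨thm2TorusAt_of_thm2SetupSUAt, thm2SetupSUAt_of_thm2TorusAt⟩

end Converse

/-! ## §2 Theorem 2 in `Thm2SetupSUAt` currency descends along the covers of a `T3Family` member -/

section Cover

variable {N : ℕ} [NeZero N]

/-- **DESCENT OF THEOREM 2 ALONG A COVER, SETUP CURRENCY.**  For a `T3Family` member `(F, K)`, a cover exponent `j`, a level `k ≤ F.m + K`,
`η > 0`, `0 < B₁`: Theorem 2 at the `SU(N)`-valued Setup-torus objects of the `Lʲ`-FOLD COVER member `(⟨L, hL, F.m + j, _⟩, K)` implies Theorem 2 at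
the Setup-torus objects of `(F, K)`, with the same `η, β₀, B₁, B₂, len` and the window constant `min c₁ (16B₁)⁻¹` — §1's converse junction at the
cover, gen 5's `Thm2TorusOfCover.thm2TorusAt_of_dvd'` (`2L^{m+K} ∣ Lʲ·2L^{m+K}`, `Lᵏ ∣ 2L^{m+K}`), and `B8Thm2SetupTorus.thm2SetupSUAt_of_thm2TorusAt`
at the base.  No Setup-level cover map is used. [cite: Balaban1985RegularSpaces, Thm 2 p.83, p.77; Balaban1985UV3, (1)-(3) p.256] -/
theorem thm2SetupSUAt_of_cover (F : T3Family) (j K : ℕ) {k : ℕ} (hk : k ≤ F.m + K) {η β₀ B₁ B₂ c₁ : ℝ} (hη : 0 < η) (hB₁ : 0 < B₁)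
    {len : LSite (F.P K).d → ℝ} {Reg : (LSite (F.P K).d → Fin (F.P K).d → (Matrix (Fin N) (Fin N) ℂ)ˣ) → Prop}
    (h : Thm2SetupSUAt ((⟨F.L, F.hL, F.m + j, le_add_right F.hm⟩ : T3Family).P K) N k η β₀ B₁ B₂ c₁ len Reg) :
    Thm2SetupSUAt (F.P K) N k η β₀ B₁ B₂ (min c₁ (16 * B₁)⁻¹) len Reg := by
  haveI : Nonempty (Fin N) := ⟨⟨0, Nat.pos_of_ne_zero (NeZero.ne N)⟩⟩
  have hT := thm2TorusAt_of_thm2SetupSUAt h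
  refine thm2SetupSUAt_of_thm2TorusAt (thm2TorusAt_of_dvd' (le_of_lt F.hL.2) ?_ ?_ hη hB₁ specialUnitaryUnits_le_unitaryUnits hT)
  · rw [sitesPerDir_zero_cover, Nat.cast_mul]
    exact Dvd.intro_left _ rfl
  · exact pow_dvd_period (F.P K) (by show k ≤ F.m + K - 0; omega)

/-- **… REGIME FORM, SAME WINDOW CONSTANT**: under `16·B₁·c₁ ≤ 1` (`0 ≤ B₁`) the descent keeps `c₁` (gen 5's `thm2TorusAt_of_dvd`).
[cite: Balaban1985RegularSpaces, Thm 2 p.83, p.77; Balaban1985UV3, (1)-(3) p.256] -/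
theorem thm2SetupSUAt_of_cover_of_regime (F : T3Family) (j K : ℕ) {k : ℕ} (hk : k ≤ F.m + K) {η β₀ B₁ B₂ c₁ : ℝ} (hη : 0 < η)
    (hB₁ : 0 ≤ B₁) (hBc : 16 * (B₁ * c₁) ≤ 1)
    {len : LSite (F.P K).d → ℝ} {Reg : (LSite (F.P K).d → Fin (F.P K).d → (Matrix (Fin N) (Fin N) ℂ)ˣ) → Prop}
    (h : Thm2SetupSUAt ((⟨F.L, F.hL, F.m + j, le_add_right F.hm⟩ : T3Family).P K) N k η β₀ B₁ B₂ c₁ len Reg) :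
    Thm2SetupSUAt (F.P K) N k η β₀ B₁ B₂ c₁ len Reg := by
  haveI : Nonempty (Fin N) := ⟨⟨0, Nat.pos_of_ne_zero (NeZero.ne N)⟩⟩
  have hT := thm2TorusAt_of_thm2SetupSUAt h
  refine thm2SetupSUAt_of_thm2TorusAt (thm2TorusAt_of_dvd (le_of_lt F.hL.2) ?_ ?_ hη hB₁ hBc specialUnitaryUnits_le_unitaryUnits hT)
  · rw [sitesPerDir_zero_cover, Nat.cast_mul]
    exact Dvd.intro_left _ rfl
  · exact pow_dvd_period (F.P K) (by show k ≤ F.m + K - 0; omega)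

end Cover

/-! ## §3 The EX knit's socket: a volume floor on a SETUP-currency supplier is no floor -/

section Socket

/-- **A VOLUME FLOOR ON THE THEOREM-2 SOCKET IS NO FLOOR — `Thm2SetupSUAt` CURRENCY** (gen 5's `thm2SetupSUAt_allMembers_of_floor` with the
supplier in the socket's own currency).  If a supplier delivers, with ONE pair `(B₁, c₁)`, `0 < B₁`, `∃ β₀ B₂ len, Thm2SetupSUAt (F.P K) 2 (K − n)
(eta F n K) β₀ B₁ B₂ c₁ len ⊤` for every member `(F, n, K)`, `n < K`, of block size `L` ABOVE a volume floor `k₀ ≤ F.m`, then the same holds for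
EVERY member at the window constant `min c₁ (16B₁)⁻¹` — the member is served by its `L^{k₀}`-fold cover (§2, `eta` of the cover is `eta F n K`).
[cite: Balaban1985RegularSpaces, Thm 2 p.83, p.77; Balaban1985UV3, (1)-(3) p.256; Balaban1985Variational, (2), (5) p.278] -/
theorem thm2SetupSUAt_allMembers_of_floorS {L : ℕ} {B₁ c₁ : ℝ} (hB₁ : 0 < B₁) (k₀ : ℕ)
    (h : ∀ F : T3Family, F.L = L → k₀ ≤ F.m → ∀ (n K : ℕ), n < K →
      ∃ (β₀ B₂ : ℝ) (len : LSite (F.P K).d → ℝ), Thm2SetupSUAt (F.P K) 2 (K - n) (eta F n K) β₀ B₁ B₂ c₁ len (fun _ => True))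
    (F : T3Family) (hF : F.L = L) {n K : ℕ} (hnK : n < K) :
    ∃ (β₀ B₂ : ℝ) (len : LSite (F.P K).d → ℝ),
      Thm2SetupSUAt (F.P K) 2 (K - n) (eta F n K) β₀ B₁ B₂ (min c₁ (16 * B₁)⁻¹) len (fun _ => True) := by
  obtain ⟨β₀, B₂, len, hT⟩ := h ⟨F.L, F.hL, F.m + k₀, le_add_right F.hm⟩ hF (Nat.le_add_left _ _) n K hnK
  exact ⟨β₀, B₂, len, thm2SetupSUAt_of_cover F k₀ K (by omega) (eta_pos F n K) hB₁ hT⟩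

/-- **SOCKET SHAPE.**  The EX knit's Theorem-2 socket `hThm2S` (`Prop7StubEXOfDisplayedRowsWWS.stubEX_of_displayedRows_wWS`, all members,
`∃ B₁ c₁ > 0` first, `Thm2SetupSUAt` currency) from a supplier IN THAT CURRENCY that is allowed a volume floor `k₀ ≤ F.m` per block size `L`.
[cite: Balaban1985RegularSpaces, Thm 2 p.83, p.77; Balaban1985UV3, (1)-(3) p.256] -/
theorem hThm2S_of_floorS
    (h : ∀ (L : ℕ), 1 < L → ∃ (k₀ : ℕ) (B₁ c₁ : ℝ), 0 < B₁ ∧ 0 < c₁ ∧ ∀ F : T3Family, F.L = L → k₀ ≤ F.m → ∀ (n K : ℕ), n < K →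
      ∃ (β₀ B₂ : ℝ) (len : LSite (F.P K).d → ℝ), Thm2SetupSUAt (F.P K) 2 (K - n) (eta F n K) β₀ B₁ B₂ c₁ len (fun _ => True)) :
    ∀ (L : ℕ), 1 < L → ∃ B₁ c₁ : ℝ, 0 < B₁ ∧ 0 < c₁ ∧ ∀ F : T3Family, F.L = L → ∀ (n K : ℕ), n < K →
      ∃ (β₀ B₂ : ℝ) (len : LSite (F.P K).d → ℝ), Thm2SetupSUAt (F.P K) 2 (K - n) (eta F n K) β₀ B₁ B₂ c₁ len (fun _ => True) := by
  intro L hL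
  obtain ⟨k₀, B₁, c₁, hB₁, hc₁, hS⟩ := h L hL
  exact ⟨B₁, min c₁ (16 * B₁)⁻¹, hB₁, lt_min hc₁ (by positivity), fun F hF n K hnK => thm2SetupSUAt_allMembers_of_floorS hB₁ k₀ hS F hF hnK⟩

/-- **… WITH THE SUPPLIER'S PER-MEMBER ANTECEDENT CARRIED (A14's floor shape `k₀ ≤ F.m`).**  If above the floor the supplier delivers Theorem 2 in
Setup currency FROM a per-member antecedent `H F n K` (for file A14 `B8Thm2TorusKnitCubeCore.hThm2_of_core`: the analytic cube data and the (B)-lines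
at the member, after `fun`-abstraction), then EVERY member `(F, n, K)` is served from the antecedent READ AT ITS COVER MEMBER `(⟨L, hL, F.m + k₀, _⟩,
n, K)` (period `L^{k₀}·2L^{m+K}`, same `η`, same `(B₁, c₁)`).  Nothing of `H` is discharged here. [cite: Balaban1985RegularSpaces, Thm 2 p.83, p.77; Balaban1985UV3, (1)-(3) p.256] -/
theorem thm2SetupSUAt_allMembers_of_floorS_hyp {L : ℕ} {B₁ c₁ : ℝ} (hB₁ : 0 < B₁) (k₀ : ℕ) (H : T3Family → ℕ → ℕ → Prop)
    (h : ∀ F : T3Family, F.L = L → k₀ ≤ F.m → ∀ (n K : ℕ), n < K → H F n K →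
      ∃ (β₀ B₂ : ℝ) (len : LSite (F.P K).d → ℝ), Thm2SetupSUAt (F.P K) 2 (K - n) (eta F n K) β₀ B₁ B₂ c₁ len (fun _ => True))
    (F : T3Family) (hF : F.L = L) {n K : ℕ} (hnK : n < K) (hH : H ⟨F.L, F.hL, F.m + k₀, le_add_right F.hm⟩ n K) :
    ∃ (β₀ B₂ : ℝ) (len : LSite (F.P K).d → ℝ),
      Thm2SetupSUAt (F.P K) 2 (K - n) (eta F n K) β₀ B₁ B₂ (min c₁ (16 * B₁)⁻¹) len (fun _ => True) := by
  obtain ⟨β₀, B₂, len, hT⟩ := h ⟨F.L, F.hL, F.m + k₀, le_add_right F.hm⟩ hF (Nat.le_add_left _ _) n K hnK hH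
  exact ⟨β₀, B₂, len, thm2SetupSUAt_of_cover F k₀ K (by omega) (eta_pos F n K) hB₁ hT⟩

/-- **… A15's SHARP FLOOR SHAPE `k₀ ≤ F.m + n`** (`B8Thm2T3FamilyBinderSharp.hThm2_of_core_sharp`: floor after `n K`): every member `(F, n, K)` is
served from the antecedent read at the cover member with exponent `k₀ − n`, `(⟨L, hL, F.m + (k₀ − n), _⟩, n, K)`.  Nothing of `H` is discharged.
[cite: Balaban1985RegularSpaces, Thm 2 p.83, p.77; Balaban1985UV3, (1)-(3) p.256] -/
theorem thm2SetupSUAt_allMembers_of_floorS_hyp_sharp {L : ℕ} {B₁ c₁ : ℝ} (hB₁ : 0 < B₁) (k₀ : ℕ) (H : T3Family → ℕ → ℕ → Prop)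
    (h : ∀ F : T3Family, F.L = L → ∀ (n K : ℕ), n < K → k₀ ≤ F.m + n → H F n K →
      ∃ (β₀ B₂ : ℝ) (len : LSite (F.P K).d → ℝ), Thm2SetupSUAt (F.P K) 2 (K - n) (eta F n K) β₀ B₁ B₂ c₁ len (fun _ => True))
    (F : T3Family) (hF : F.L = L) {n K : ℕ} (hnK : n < K) (hH : H ⟨F.L, F.hL, F.m + (k₀ - n), le_add_right F.hm⟩ n K) :
    ∃ (β₀ B₂ : ℝ) (len : LSite (F.P K).d → ℝ),
      Thm2SetupSUAt (F.P K) 2 (K - n) (eta F n K) β₀ B₁ B₂ (min c₁ (16 * B₁)⁻¹) len (fun _ => True) := by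
  obtain ⟨β₀, B₂, len, hT⟩ :=
    h ⟨F.L, F.hL, F.m + (k₀ - n), le_add_right F.hm⟩ hF n K hnK (by show k₀ ≤ F.m + (k₀ - n) + n; omega) hH
  exact ⟨β₀, B₂, len, thm2SetupSUAt_of_cover F (k₀ - n) K (by omega) (eta_pos F n K) hB₁ hT⟩

end Socket

end Summit.QuantumFields.YangMills.BalabanUVNodes.N16.Thm2SetupTorusOfCover
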